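import Summits.QuantumFields.QCD.Theorems.ExtinctionBuildsQCD.Negative.InertiaPencil
import Mathlib.LinearAlgebra.Matrix.SchurComplement

/-!
# Haynsworth inertia additivity and the off-block rank slack

Helper (1/2) for stub `stub_inertiaMonotone` (S7, reshape r3) of line `free-volume-heavy-witness`
(crux `Summit.QuantumFields.QCD.Theses.SpectralDefectExtinction.WindowExtinction`,
item stmt-QuantumFields-8964).  Pure finite-dimensional linear algebra over `ℂ`, in terms of the
negative root count `negRootCount M = #{roots of charpoly M with negative real part}` of
`ExtinctionBuildsQCD/Negative/InertiaPencil.lean` (for Hermitian `M`: the number of negative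
eigenvalues, `negRootCount_eq_card`).

* `inertia_negRootCount_conj_le` — `n₋(Gᴴ Y G) ≤ n₋(Y)` for Hermitian `Y` and ANY square `G`
  (min–max: the negative eigenspace of `Gᴴ Y G`, pushed forward by `G`, is `Y`-negative);
  `inertia_negRootCount_congr` — Sylvester's law of inertia `n₋(L X Lᴴ) = n₋(X)`, `L` invertible.
* `inertia_haynsworth` — Haynsworth inertia additivity
  `n₋([[A, B], [Bᴴ, D]]) = n₋(A) + n₋(D − Bᴴ A⁻¹ B)` for invertible Hermitian `A` (LDU congruence
  `Matrix.fromBlocks_eq_of_invertible₁₁` + Sylvester + `charpoly` of a block-diagonal matrix);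
  `inertia_negRootCount_eq_blocks` — the same for the principal block of a Hermitian matrix cut
  out by a decidable predicate (the Schur complement is returned through its action on vectors).
* `inertia_negRootCount_le_add_card` — if two Hermitian forms agree on the vectors vanishing on a
  finite set `K` of coordinates, their negative counts differ by at most `#K` (rank–nullity on the
  negative test space).
* `inertia_offBlock_monotone` — the assembled OFF-BLOCK MONOTONICITY: two Hermitian `H, H'` on `ι`
  with the same outside block (indices `¬P`), whose inside/outside couplings are supported on the
  columns `K`, and with invertible inside blocks `A, A'`, satisfy
  `n₋(H) − n₋(A) ≤ n₋(H') − n₋(A') + #K`.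

References: Haynsworth, Linear Algebra Appl. 1 (1968) 73–81 (inertia additivity); Horn–Johnson,
*Matrix Analysis* (1985), Thm. 4.5.8 (Sylvester) and §4.3 (interlacing / rank perturbations).
-/

noncomputable section

namespace Summit.QuantumFields.QCD.Cruxes.WindowExtinction.FreeVolumeHeavyWitness

open Matrix
open Summit.QuantumFields.QCD.Theorems.ExtinctionBuildsQCD.Negative
open scoped BigOperators ComplexConjugate

section Sylvester

variable {n : Type*} [Fintype n] [DecidableEq n]

/-- **The negative test map** of a Hermitian matrix `X = U diag(λ) Uᴴ` — coordinates on the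
negative eigenvalues, extended by zero and rotated by the eigenvector unitary `U` — makes the
Hermitian form negative (off `c = 0`): `Re⟨U ext c, X U ext c⟩ = Σ_{λ_i < 0} λ_i ‖c_i‖² < 0`. -/
theorem inertia_negMap_form_neg {X : Matrix n n ℂ} (hX : X.IsHermitian)
    (c : {i // hX.eigenvalues i < 0} → ℂ) (hc : c ≠ 0) :
    (star ((hX.eigenvectorUnitary : Matrix n n ℂ) *ᵥ extendByZero (fun i => hX.eigenvalues i < 0) c)
      ⬝ᵥ (X *ᵥ ((hX.eigenvectorUnitary : Matrix n n ℂ) *ᵥ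
        extendByZero (fun i => hX.eigenvalues i < 0) c))).re < 0 := by
  have hUmem : (hX.eigenvectorUnitary : Matrix n n ℂ) ∈ Matrix.unitaryGroup n ℂ :=
    hX.eigenvectorUnitary.2
  rw [re_form_eq_sum_eigenvalues hX, conjTranspose_mulVec_mulVec_of_mem_unitaryGroup hUmem]
  obtain ⟨j, hj⟩ := Function.ne_iff.mp hc
  have hj' : c j ≠ 0 := hj
  have hle : ∀ i,
      hX.eigenvalues i * ‖extendByZero (fun i => hX.eigenvalues i < 0) c i‖ ^ 2 ≤ 0 := by
    intro i
    by_cases hi : hX.eigenvalues i < 0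
    · exact mul_nonpos_of_nonpos_of_nonneg hi.le (by positivity)
    · rw [extendByZero_apply_of_neg c hi, norm_zero]
      simp
  have hlt : hX.eigenvalues j.1 *
      ‖extendByZero (fun i => hX.eigenvalues i < 0) c j.1‖ ^ 2 < 0 := by
    rw [extendByZero_apply_of_pos c j.2]
    exact mul_neg_of_neg_of_pos j.2 (pow_pos (norm_pos_iff.mpr hj') 2)
  calc ∑ i, hX.eigenvalues i * ‖extendByZero (fun i => hX.eigenvalues i < 0) c i‖ ^ 2
      < ∑ _i : n, (0 : ℝ) :=
        Finset.sum_lt_sum (fun i _ => hle i) ⟨j.1, Finset.mem_univ _, hlt⟩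
    _ = 0 := Finset.sum_const_zero

omit [DecidableEq n] in
/-- Transport of the Hermitian form under `w ↦ G w`: `⟨Gw, Y Gw⟩ = ⟨w, (Gᴴ Y G) w⟩`. -/
theorem inertia_form_conj (Y G : Matrix n n ℂ) (w : n → ℂ) :
    star (G *ᵥ w) ⬝ᵥ (Y *ᵥ (G *ᵥ w)) = star w ⬝ᵥ ((Gᴴ * Y * G) *ᵥ w) := by
  rw [star_mulVec, ← dotProduct_mulVec, mulVec_mulVec, mulVec_mulVec]

/-- **Monotonicity of the negative count under congruence by an arbitrary square matrix**:
`n₋(Gᴴ Y G) ≤ n₋(Y)` for Hermitian `Y` (the negative test space of `Gᴴ Y G`, pushed forward by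
`G`, is a `Y`-negative space of the same dimension). -/
theorem inertia_negRootCount_conj_le {Y : Matrix n n ℂ} (hY : Y.IsHermitian) (G : Matrix n n ℂ) :
    negRootCount (Gᴴ * Y * G) ≤ negRootCount Y := by
  have hX : (Gᴴ * Y * G).IsHermitian := isHermitian_conjTranspose_mul_mul G hY
  rw [negRootCount_eq_card hX, negRootCount_eq_card hY, ← Fintype.card_subtype]
  have h := card_le_card_eigenvalues_of_form_pos hY (-1)
    (Matrix.mulVecLin G ∘ₗ (Matrix.mulVecLin (hX.eigenvectorUnitary : Matrix n n ℂ) ∘ₗ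
      extendByZero (fun i => hX.eigenvalues i < 0))) (fun c hc => ?_)
  · simpa only [neg_mul, one_mul, Left.neg_pos_iff] using h
  · have := inertia_negMap_form_neg hX c hc
    simp only [LinearMap.coe_comp, Function.comp_apply, Matrix.mulVecLin_apply]
    rw [inertia_form_conj]
    linarith

/-- **Sylvester's law of inertia** (negative count): `n₋(L X Lᴴ) = n₋(X)` for Hermitian `X` and
invertible `L`. -/
theorem inertia_negRootCount_congr {X : Matrix n n ℂ} (hX : X.IsHermitian) (L : Matrix n n ℂ)
    [Invertible L] : negRootCount (L * X * Lᴴ) = negRootCount X := by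
  have hY : (L * X * Lᴴ).IsHermitian := isHermitian_mul_mul_conjTranspose L hX
  refine le_antisymm ?_ ?_
  · have h : L * X * Lᴴ = (Lᴴ)ᴴ * X * Lᴴ := by rw [conjTranspose_conjTranspose]
    rw [h]
    exact inertia_negRootCount_conj_le hX Lᴴ
  · have h : ((⅟L)ᴴ)ᴴ * (L * X * Lᴴ) * (⅟L)ᴴ = X := by
      rw [conjTranspose_conjTranspose, Matrix.mul_assoc L X, Matrix.invOf_mul_cancel_left,
        Matrix.mul_assoc, ← conjTranspose_mul, invOf_mul_self, conjTranspose_one, Matrix.mul_one]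
    calc negRootCount X = negRootCount (((⅟L)ᴴ)ᴴ * (L * X * Lᴴ) * (⅟L)ᴴ) := by rw [h]
      _ ≤ negRootCount (L * X * Lᴴ) := inertia_negRootCount_conj_le hY _

/-- The negative count is invariant under re-indexing along an equivalence. -/
theorem inertia_negRootCount_submatrix_equiv {m : Type*} [Fintype m] [DecidableEq m] (e : m ≃ n)
    (H : Matrix n n ℂ) : negRootCount (H.submatrix e e) = negRootCount H := by
  have h : H.submatrix e e = reindex e.symm e.symm H := by
    simp only [reindex_apply, Equiv.symm_symm]
  unfold negRootCount
  rw [h, charpoly_reindex]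

/-- `card_le_card_eigenvalues_of_form_pos` for a finite-dimensional source: if
`s · Re⟨Ev, A Ev⟩ > 0` off `v = 0`, then `dim V ≤ #{i | s λ_i > 0}`. -/
theorem inertia_finrank_le_card {A : Matrix n n ℂ} (hA : A.IsHermitian) (s : ℝ)
    {V : Type*} [AddCommGroup V] [Module ℂ V] [FiniteDimensional ℂ V] (E : V →ₗ[ℂ] (n → ℂ))
    (hpos : ∀ v : V, v ≠ 0 → 0 < s * (star (E v) ⬝ᵥ (A *ᵥ E v)).re) :
    Module.finrank ℂ V ≤ (Finset.univ.filter fun i => 0 < s * hA.eigenvalues i).card := by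
  let b := Module.finBasis ℂ V
  have h := card_le_card_eigenvalues_of_form_pos hA s
    (E ∘ₗ (b.equivFun.symm : (Fin (Module.finrank ℂ V) → ℂ) →ₗ[ℂ] V)) (fun c hc => ?_)
  · simpa only [Fintype.card_fin] using h
  · have hv : b.equivFun.symm c ≠ 0 := (LinearEquiv.map_ne_zero_iff _).mpr hc
    exact hpos _ hv

end Sylvester

section Haynsworth

variable {m k : Type*} [Fintype m] [DecidableEq m] [Fintype k] [DecidableEq k]

/-- The negative count of a block-diagonal matrix is the sum of the negative counts of the blocks
(`charpoly` multiplies). -/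
theorem inertia_negRootCount_fromBlocks_diag (A : Matrix m m ℂ) (M : Matrix k k ℂ) :
    negRootCount (fromBlocks A 0 0 M) = negRootCount A + negRootCount M := by
  unfold negRootCount
  rw [charpoly_fromBlocks_zero₁₂,
    Polynomial.roots_mul (mul_ne_zero (charpoly_monic A).ne_zero (charpoly_monic M).ne_zero),
    Multiset.countP_add]

/-- **Haynsworth inertia additivity** (negative count): for Hermitian `A` (invertible) and `D`,
`n₋([[A, B], [Bᴴ, D]]) = n₋(A) + n₋(D − Bᴴ A⁻¹ B)`.  Proof: the LDU factorisation
`[[A, B], [Bᴴ, D]] = L · (A ⊕ (D − Bᴴ A⁻¹ B)) · Lᴴ`, `L = [[1, 0], [Bᴴ A⁻¹, 1]]`, and Sylvester. -/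
theorem inertia_haynsworth {A : Matrix m m ℂ} (hA : A.IsHermitian) (B : Matrix m k ℂ)
    {D : Matrix k k ℂ} (hD : D.IsHermitian) [Invertible A] :
    negRootCount (fromBlocks A B Bᴴ D) = negRootCount A + negRootCount (D - Bᴴ * ⅟A * B) := by
  have hAi : (⅟A).IsHermitian := by
    rw [invOf_eq_nonsing_inv]
    exact hA.inv
  have hM : (D - Bᴴ * ⅟A * B).IsHermitian := hD.sub (isHermitian_conjTranspose_mul_mul B hAi)
  have hX : (fromBlocks A 0 0 (D - Bᴴ * ⅟A * B)).IsHermitian :=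
    hA.fromBlocks (conjTranspose_zero) hM
  letI : Invertible (1 : Matrix m m ℂ) := invertibleOne
  letI : Invertible (1 : Matrix k k ℂ) := invertibleOne
  letI : Invertible (fromBlocks (1 : Matrix m m ℂ) 0 (Bᴴ * ⅟A) (1 : Matrix k k ℂ)) :=
    fromBlocksZero₁₂Invertible _ _ _
  have hL : fromBlocks (1 : Matrix m m ℂ) (⅟A * B) 0 (1 : Matrix k k ℂ) =
      (fromBlocks (1 : Matrix m m ℂ) 0 (Bᴴ * ⅟A) (1 : Matrix k k ℂ))ᴴ := by
    rw [fromBlocks_conjTranspose, conjTranspose_one, conjTranspose_one, conjTranspose_zero,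
      conjTranspose_mul, conjTranspose_conjTranspose, hAi.eq]
  rw [fromBlocks_eq_of_invertible₁₁ (A := A), hL, inertia_negRootCount_congr hX]
  exact (inertia_negRootCount_fromBlocks_diag _ _).trans rfl

variable {ι : Type*} [Fintype ι] [DecidableEq ι]

omit [DecidableEq k] in
/-- The Schur complement acting on a vector. -/
theorem inertia_schur_mulVec (A : Matrix m m ℂ) [Invertible A] (B : Matrix m k ℂ)
    (S : Matrix k k ℂ) (v : k → ℂ) :
    (S - Bᴴ * ⅟A * B) *ᵥ v = S *ᵥ v - Bᴴ *ᵥ (A⁻¹ *ᵥ (B *ᵥ v)) := by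
  rw [sub_mulVec, ← mulVec_mulVec, ← mulVec_mulVec, invOf_eq_nonsing_inv]

/-- **Haynsworth for a principal block cut out by a predicate.** For a Hermitian `H` on `ι` and a
decidable predicate `P` whose principal block `A = H|_{P×P}` is invertible:
`n₋(H) = n₋(A) + n₋(M)` for a Hermitian `M` (the Schur complement `S − Bᴴ A⁻¹ B`,
`B = H|_{P×¬P}`, `S = H|_{¬P×¬P}`, recorded through its action on vectors). -/
theorem inertia_negRootCount_eq_blocks (P : ι → Prop) [DecidablePred P] {H : Matrix ι ι ℂ}
    (hH : H.IsHermitian)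
    (hA : (H.submatrix (Subtype.val : {i // P i} → ι) Subtype.val).det ≠ 0) :
    ∃ M : Matrix {i // ¬ P i} {i // ¬ P i} ℂ, M.IsHermitian ∧
      (∀ v : {i // ¬ P i} → ℂ, M *ᵥ v =
        H.submatrix (Subtype.val : {i // ¬ P i} → ι) (Subtype.val : {i // ¬ P i} → ι) *ᵥ v -
          (H.submatrix (Subtype.val : {i // P i} → ι) (Subtype.val : {i // ¬ P i} → ι))ᴴ *ᵥ
            ((H.submatrix (Subtype.val : {i // P i} → ι) (Subtype.val : {i // P i} → ι))⁻¹ *ᵥ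
              (H.submatrix (Subtype.val : {i // P i} → ι) (Subtype.val : {i // ¬ P i} → ι) *ᵥ
                v))) ∧
      negRootCount H =
        negRootCount (H.submatrix (Subtype.val : {i // P i} → ι) Subtype.val) + negRootCount M := by
  set A := H.submatrix (Subtype.val : {i // P i} → ι) (Subtype.val : {i // P i} → ι)
  set B := H.submatrix (Subtype.val : {i // P i} → ι) (Subtype.val : {i // ¬ P i} → ι)
    with hBdef
  set S := H.submatrix (Subtype.val : {i // ¬ P i} → ι) (Subtype.val : {i // ¬ P i} → ι)
  have hblk : H.submatrix (Equiv.sumCompl P) (Equiv.sumCompl P) = fromBlocks A B Bᴴ S := by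
    ext (i | i) (j | j)
    · rfl
    · rfl
    · simp only [submatrix_apply, Equiv.sumCompl_apply_inr, Equiv.sumCompl_apply_inl,
        fromBlocks_apply₂₁, conjTranspose_apply, hBdef]
      exact (hH.apply _ _).symm
    · rfl
  have hAh : A.IsHermitian := hH.submatrix _
  have hSh : S.IsHermitian := hH.submatrix _
  letI : Invertible A := invertibleOfIsUnitDet A (isUnit_iff_ne_zero.mpr hA)
  have hAi : (⅟A).IsHermitian := by
    rw [invOf_eq_nonsing_inv]
    exact hAh.inv
  have heq := inertia_haynsworth hAh B hSh
  rw [← hblk, inertia_negRootCount_submatrix_equiv] at heq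
  exact ⟨_, hSh.sub (isHermitian_conjTranspose_mul_mul B hAi),
    fun v => inertia_schur_mulVec A B S v, heq⟩

end Haynsworth

section Slack

variable {k : Type*} [Fintype k] [DecidableEq k]

/-- **Rank slack.** If the forms of two Hermitian matrices agree on the vectors vanishing on a
finite set `K` of coordinates, then `n₋(M) ≤ n₋(M') + #K`: the negative test space of `M` meets
`{v | v|_K = 0}` in dimension `≥ n₋(M) − #K` (rank–nullity), and `M'` is negative there. -/
theorem inertia_negRootCount_le_add_card {M M' : Matrix k k ℂ} (hM : M.IsHermitian)
    (hM' : M'.IsHermitian) (K : Finset k)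
    (hform : ∀ v : k → ℂ, (∀ q ∈ K, v q = 0) →
      star v ⬝ᵥ (M' *ᵥ v) = star v ⬝ᵥ (M *ᵥ v)) :
    negRootCount M ≤ negRootCount M' + K.card := by
  -- the negative test map `E = U ∘ ext` of `M` and its restriction `π` to the coordinates in `K`
  set E : ({i // hM.eigenvalues i < 0} → ℂ) →ₗ[ℂ] (k → ℂ) :=
    Matrix.mulVecLin (hM.eigenvectorUnitary : Matrix k k ℂ) ∘ₗ
      extendByZero (fun i => hM.eigenvalues i < 0) with hE
  set π : ({i // hM.eigenvalues i < 0} → ℂ) →ₗ[ℂ] (↥K → ℂ) :=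
    (LinearMap.funLeft ℂ ℂ (Subtype.val : ↥K → k)) ∘ₗ E with hπ
  have hrank : Module.finrank ℂ ({i // hM.eigenvalues i < 0} → ℂ) ≤
      Module.finrank ℂ (LinearMap.ker π) + K.card := by
    have h1 := LinearMap.finrank_range_add_finrank_ker π
    have h2 : Module.finrank ℂ (LinearMap.range π) ≤ K.card :=
      calc Module.finrank ℂ (LinearMap.range π)
          ≤ Module.finrank ℂ (↥K → ℂ) := Submodule.finrank_le _
        _ = K.card := by rw [Module.finrank_fintype_fun_eq_card, Fintype.card_coe]
    omega
  -- `M'` is negative on the image of the kernel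
  have hker : Module.finrank ℂ (LinearMap.ker π) ≤
      (Finset.univ.filter fun i => 0 < (-1) * hM'.eigenvalues i).card := by
    refine inertia_finrank_le_card hM' (-1) (E ∘ₗ (LinearMap.ker π).subtype) (fun w hw => ?_)
    have hw' : (w : {i // hM.eigenvalues i < 0} → ℂ) ≠ 0 := fun h =>
      hw ((Submodule.coe_eq_zero).mp h)
    have hneg := inertia_negMap_form_neg hM w hw'
    have hvan : ∀ q ∈ K, E w q = 0 := fun q hq => by
      have h0 : π w = 0 := LinearMap.mem_ker.mp w.2
      exact congrFun h0 ⟨q, hq⟩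
    have hEw : E w = (hM.eigenvectorUnitary : Matrix k k ℂ) *ᵥ
        extendByZero (fun i => hM.eigenvalues i < 0) w := rfl
    simp only [LinearMap.coe_comp, Function.comp_apply, Submodule.coe_subtype]
    rw [hform _ hvan, hEw]
    linarith
  have hk : negRootCount M = Module.finrank ℂ ({i // hM.eigenvalues i < 0} → ℂ) := by
    rw [negRootCount_eq_card hM, Module.finrank_fintype_fun_eq_card, Fintype.card_subtype]
  have hk' : (Finset.univ.filter fun i => 0 < (-1) * hM'.eigenvalues i).card =
      negRootCount M' := by
    rw [negRootCount_eq_card hM']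
    simp only [neg_mul, one_mul, Left.neg_pos_iff]
  omega

end Slack

section OffBlock

/-- **Off-block monotonicity of the inertia.**  Let `H, H'` be Hermitian on `ι`, `P` a decidable
predicate ("inside") and `K` a finite set of indices such that: `H` and `H'` agree outside
(`¬P × ¬P`), the inside/outside couplings of both vanish off the columns in `K`, and both inside
blocks `A = H|_{P×P}`, `A' = H'|_{P×P}` are invertible.  Then
`n₋(H) + n₋(A') ≤ n₋(H') + n₋(A) + #K`, i.e. `n₋(H') − n₋(H) ≥ [n₋(A') − n₋(A)] − #K`.
Proof: Haynsworth `n₋(H) = n₋(A) + n₋(S − BᴴA⁻¹B)` for both, and the two Schur complements have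
the same form on `{v | v|_K = 0}` (there `Bv = B'v = 0`), so their negative counts differ by at
most `#K`. -/
theorem inertia_offBlock_monotone :
    ∀ {ι : Type*} [Fintype ι] [DecidableEq ι] (P : ι → Prop) [DecidablePred P] (K : Finset ι)
      {H H' : Matrix ι ι ℂ}, H.IsHermitian → H'.IsHermitian →
      (∀ i j, ¬ P i → ¬ P j → H' i j = H i j) →
      (∀ i j, P i → ¬ P j → j ∉ K → H i j = 0) →
      (∀ i j, P i → ¬ P j → j ∉ K → H' i j = 0) →
      (H.submatrix (Subtype.val : {i // P i} → ι) Subtype.val).det ≠ 0 →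
      (H'.submatrix (Subtype.val : {i // P i} → ι) Subtype.val).det ≠ 0 →
      negRootCount H + negRootCount (H'.submatrix (Subtype.val : {i // P i} → ι) Subtype.val) ≤
        negRootCount H' + negRootCount (H.submatrix (Subtype.val : {i // P i} → ι) Subtype.val) +
          K.card := by
  intro ι _ _ P _ K H H' hH hH' hS hB hB' hA hA'
  obtain ⟨M, hM, hMv, h1⟩ := inertia_negRootCount_eq_blocks P hH hA
  obtain ⟨M', hM', hM'v, h2⟩ := inertia_negRootCount_eq_blocks P hH' hA'
  -- off-block support: the couplings kill the vectors vanishing on `K`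
  have hBv : ∀ {G : Matrix ι ι ℂ}, (∀ i j, P i → ¬ P j → j ∉ K → G i j = 0) →
      ∀ v : {i // ¬ P i} → ℂ, (∀ q ∈ K.subtype (fun i => ¬ P i), v q = 0) →
        (G.submatrix (Subtype.val : {i // P i} → ι) (Subtype.val : {i // ¬ P i} → ι)) *ᵥ v
          = 0 := by
    intro G hG v hv
    funext i
    change ∑ j : {i // ¬ P i}, G i.1 j.1 * v j = 0
    refine Finset.sum_eq_zero fun j _ => ?_
    by_cases hj : (j : ι) ∈ K
    · rw [hv j (Finset.mem_subtype.2 hj), mul_zero]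
    · rw [hG i.1 j.1 i.2 j.2 hj, zero_mul]
  -- the common outside block
  have hSS : H'.submatrix (Subtype.val : {i // ¬ P i} → ι) (Subtype.val : {i // ¬ P i} → ι) =
      H.submatrix (Subtype.val : {i // ¬ P i} → ι) (Subtype.val : {i // ¬ P i} → ι) := by
    ext i j
    exact hS i.1 j.1 i.2 j.2
  -- rank slack between the two Schur complements
  have h3 := inertia_negRootCount_le_add_card hM hM' (K.subtype fun i => ¬ P i) (fun v hv => by
    rw [hMv, hM'v, hBv hB v hv, hBv hB' v hv, hSS]
    simp only [mulVec_zero, sub_zero])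
  have h4 : (K.subtype fun i => ¬ P i).card ≤ K.card := by
    rw [Finset.card_subtype]
    exact Finset.card_filter_le _ _
  omega

end OffBlock

end Summit.QuantumFields.QCD.Cruxes.WindowExtinction.FreeVolumeHeavyWitness

end
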